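import Literature.NumberTheory.EllipticCurves.NeronLocalHeight
import Mathlib.NumberTheory.Height.NumberField
import HarnessLib

/-!
# The places of `ℚ`: product formula and the naive height as a sum of naive local heights

Topic `NumberTheory/EllipticCurves` (family `abc`, G06; also `bsd`). Unconditional lemmas towards
the local decomposition of the canonical height over `ℚ` (ATAEC VI.2.1, the named fact
`WeierstrassCurve.Affine.Point.canonicalHeight_eq_two_mul_sum_neronLocalHeight` of
`NeronLocalHeight.lean`), with the places of `ℚ` indexed as there: the real place
`Rat.AbsoluteValue.real` and the `p`-adic places `Rat.HeightOneSpectrum.padicAbv v`,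
`v : HeightOneSpectrum ℤ` (`p = Rat.HeightOneSpectrum.natGenerator v`).

* `log_natCast_eq_sum_natGenerator`, `finsum_factorization_mul_log_natGenerator`: the logarithm of a
  positive integer from its factorisation indexed by the finite places of `ℤ`;
* `Rat.log_padicAbv`: `log |r|_v = (ord_p(den r) − ord_p(num r)) log p_v`;
* `Rat.log_abs_add_finsum_log_padicAbv` — the **product formula** for `ℚ` in logarithmic form,
  `log |r| + Σ_p log |r|_p = 0` for `r ≠ 0` (Silverman, AEC VIII.5.3 for `K = ℚ`; Ostrowski);
* `Rat.posLog_abs_add_finsum_posLog_padicAbv` — `log⁺|r| + Σ_p log⁺|r|_p = h(r) = log max(|num r|, den r)`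
  (AEC VIII.5, the height of a rational number; Mathlib `Rat.logHeight₁_eq_log_max`);
* `WeierstrassCurve.Affine.Point.naiveHeight_eq_two_mul` — the naive height of a rational point is
  twice the sum of Tate's naive local heights `λ₁,v = ½ log⁺|x|_v` over all places (the "naive"
  case of ATAEC VI.2.1, `c_v = 0` in its proof, p. 461), with the finiteness of the support.

## References

* J. H. Silverman, *The Arithmetic of Elliptic Curves*, 2nd ed. (2009), VIII.5 (product formula
  VIII.5.3, heights on `ℙⁿ(ℚ)`); *Advanced Topics*, GTM 151 (1994), proof of Thm. VI.2.1 (p. 461).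
-/

noncomputable section

open scoped Classical

open IsDedekindDomain Rat.HeightOneSpectrum

namespace Literature.NumberTheory.EllipticCurves

/-! ### Finite places of `ℤ` and prime numbers -/

/-- Distinct finite places of `ℤ` have distinct residue characteristics
(`Rat.HeightOneSpectrum.primesEquiv` is a bijection onto the primes). [folklore] -/
theorem natGenerator_injective_int :
    Function.Injective (natGenerator : HeightOneSpectrum ℤ → ℕ) := fun _ _ h =>
  primesEquiv.injective (Subtype.ext h)

/-- `log n = Σ_v e_v log p_v` when `n = ∏_p p^{e_{v(p)}}`: the logarithm of a positive integer from
its factorisation indexed by the finite places of `ℤ`, summed over any finite set of places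
containing those with `e_v ≠ 0`. [folklore] -/
theorem log_natCast_eq_sum_natGenerator {n : ℕ} (hn : n ≠ 0) {e : HeightOneSpectrum ℤ → ℕ}
    (he : ∀ v, n.factorization (natGenerator v) = e v) {T : Finset (HeightOneSpectrum ℤ)}
    (hT : ∀ v, e v ≠ 0 → v ∈ T) :
    Real.log n = ∑ v ∈ T, (e v : ℝ) * Real.log (natGenerator v) := by
  have h1 : Real.log n = ∑ p ∈ n.primeFactors, (n.factorization p : ℝ) * Real.log p := by
    conv_lhs => rw [← Nat.prod_factorization_pow_eq_self hn, Nat.prod_factorization_eq_prod_primeFactors]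
    rw [Nat.cast_prod, Real.log_prod]
    · exact Finset.sum_congr rfl fun p _ => by rw [Nat.cast_pow, Real.log_pow]
    · intro p hp
      exact_mod_cast pow_ne_zero _ (Nat.prime_of_mem_primeFactors hp).ne_zero
  have h2 : ∑ v ∈ T, (e v : ℝ) * Real.log (natGenerator v) =
      ∑ p ∈ T.image natGenerator, (n.factorization p : ℝ) * Real.log p := by
    rw [Finset.sum_image fun _ _ _ _ h => natGenerator_injective_int h]
    exact Finset.sum_congr rfl fun v _ => by rw [he v]
  rw [h2, h1]
  apply Finset.sum_subset
  · intro p hp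
    have hpp : p.Prime := Nat.prime_of_mem_primeFactors hp
    have hv : natGenerator (primesEquiv.symm ⟨p, hpp⟩ : HeightOneSpectrum ℤ) = p :=
      congrArg Subtype.val (primesEquiv.apply_symm_apply ⟨p, hpp⟩)
    have hne : e (primesEquiv.symm ⟨p, hpp⟩) ≠ 0 := by
      rw [← he, hv]
      exact Finsupp.mem_support_iff.mp (by rwa [Nat.support_factorization])
    exact Finset.mem_image.mpr ⟨_, hT _ hne, hv⟩
  · intro p _ hp
    have : n.factorization p = 0 :=
      Finsupp.notMem_support_iff.mp (by rwa [Nat.support_factorization])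
    simp [this]

/-- The function `v ↦ ord_{p_v}(n) · log p_v` is finitely supported (on the places above the prime
factors of `n`). [folklore] -/
theorem finite_support_factorization_mul_log (n : ℕ) :
    (Function.support fun v : HeightOneSpectrum ℤ =>
        (n.factorization (natGenerator v) : ℝ) * Real.log (natGenerator v)).Finite := by
  refine Set.Finite.subset ((n.primeFactors.finite_toSet.preimage
    natGenerator_injective_int.injOn)) fun v hv => ?_
  rw [Set.mem_preimage, Finset.mem_coe, ← Nat.support_factorization, Finsupp.mem_support_iff]
  intro h
  exact hv (by simp [h])

/-- `Σᶠ_v ord_{p_v}(n) log p_v = log n` for `n ≠ 0` (a finite sum over the prime factors of `n`).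
[folklore] -/
theorem finsum_factorization_mul_log_natGenerator {n : ℕ} (hn : n ≠ 0) :
    ∑ᶠ v : HeightOneSpectrum ℤ, (n.factorization (natGenerator v) : ℝ) * Real.log (natGenerator v) =
      Real.log n := by
  have hfin := finite_support_factorization_mul_log n
  rw [finsum_eq_sum_of_support_subset _ (s := hfin.toFinset) (by simp)]
  refine (log_natCast_eq_sum_natGenerator hn (fun _ => rfl) fun v hv => ?_).symm
  rw [Set.Finite.mem_toFinset, Function.mem_support]
  exact mul_ne_zero (by exact_mod_cast hv)
    (Real.log_pos (by exact_mod_cast (prime_natGenerator v).one_lt)).ne'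

/-! ### The `p`-adic absolute values of a rational number -/

namespace Rat

/-- `log |r|_v = (ord_p(den r) − ord_p(|num r|)) · log p` for `r ≠ 0`, `p = p_v`
(`|r|_p = p^{-ord_p(r)}`, Mathlib `padicNorm.eq_zpow_of_nonzero`). [folklore] -/
theorem log_padicAbv {r : ℚ} (hr : r ≠ 0) (v : HeightOneSpectrum ℤ) :
    Real.log (padicAbv v r) =
      ((r.den.factorization (natGenerator v) : ℝ) -
          (r.num.natAbs.factorization (natGenerator v) : ℝ)) *
        Real.log (natGenerator v) := by
  have hp : (natGenerator v).Prime := prime_natGenerator v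
  haveI : Fact (natGenerator v).Prime := ⟨hp⟩
  rw [padicAbv_apply, padicNorm.eq_zpow_of_nonzero hr, Rat.cast_zpow, Rat.cast_natCast,
    Real.log_zpow, Nat.factorization_def _ hp, Nat.factorization_def _ hp]
  simp only [padicValRat, padicValInt, neg_sub, Int.cast_sub, Int.cast_natCast]

/-- The function `v ↦ log |r|_v` is finitely supported (on the places above the prime factors of
`num r · den r`). [folklore] -/
theorem finite_support_log_padicAbv {r : ℚ} (hr : r ≠ 0) :
    (Function.support fun v : HeightOneSpectrum ℤ => Real.log (padicAbv v r)).Finite := by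
  refine Set.Finite.subset ((finite_support_factorization_mul_log r.den).union
    (finite_support_factorization_mul_log r.num.natAbs)) fun v hv => ?_
  rw [Function.mem_support, log_padicAbv hr, sub_mul] at hv
  by_contra h
  rw [Set.mem_union, Function.mem_support, Function.mem_support, not_or, not_not, not_not] at h
  exact hv (by rw [h.1, h.2, sub_zero])

/-- **Product formula for `ℚ`** (logarithmic form): `log |r| + Σ_p log |r|_p = 0` for `r ≠ 0`, the
sum over the `p`-adic places being finite (Silverman, AEC VIII.5.3 with `K = ℚ`; Ostrowski).
[folklore] -/
theorem log_abs_add_finsum_log_padicAbv {r : ℚ} (hr : r ≠ 0) :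
    Real.log |(r : ℝ)| + ∑ᶠ v : HeightOneSpectrum ℤ, Real.log (padicAbv v r) = 0 := by
  have hnum : r.num.natAbs ≠ 0 := Int.natAbs_ne_zero.mpr (Rat.num_ne_zero.mpr hr)
  have hden : r.den ≠ 0 := r.den_nz
  have hfd := finite_support_factorization_mul_log r.den
  have hfn := finite_support_factorization_mul_log r.num.natAbs
  have h1 : ∑ᶠ v : HeightOneSpectrum ℤ, Real.log (padicAbv v r) =
      Real.log r.den - Real.log r.num.natAbs := by
    rw [← finsum_factorization_mul_log_natGenerator hden,
      ← finsum_factorization_mul_log_natGenerator hnum, ← finsum_sub_distrib hfd hfn]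
    exact finsum_congr fun v => by rw [log_padicAbv hr, sub_mul]
  have h2 : Real.log |(r : ℝ)| = Real.log r.num.natAbs - Real.log r.den := by
    have hr' : (r : ℝ) = (r.num : ℝ) / (r.den : ℝ) := by
      rw [← Rat.cast_intCast, ← Rat.cast_natCast, ← Rat.cast_div, Rat.num_div_den]
    rw [hr', abs_div, Nat.abs_cast, ← Int.cast_abs, Int.abs_eq_natAbs, Int.cast_natCast,
      Real.log_div (by exact_mod_cast hnum) (by exact_mod_cast hden)]
  rw [h1, h2]
  ring

/-- `log⁺ |r|_v = ord_p(den r) · log p`: for `r = a/b` in lowest terms, `|r|_p > 1` exactly when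
`p ∣ b`, and then `|r|_p = p^{ord_p(b)}`. [folklore] -/
theorem posLog_padicAbv (r : ℚ) (v : HeightOneSpectrum ℤ) :
    Real.posLog (padicAbv v r) =
      (r.den.factorization (natGenerator v) : ℝ) * Real.log (natGenerator v) := by
  by_cases hr : r = 0
  · subst hr
    simp
  have hp : (natGenerator v).Prime := prime_natGenerator v
  have hlogp : 0 < Real.log (natGenerator v) := Real.log_pos (by exact_mod_cast hp.one_lt)
  have hcop : r.num.natAbs.Coprime r.den := r.reduced
  by_cases hdvd : natGenerator v ∣ r.den
  · -- `p ∣ den`, so `p ∤ num` and `|r|_p = p^{ord_p den} ≥ 1`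
    have hnum : r.num.natAbs.factorization (natGenerator v) = 0 := by
      apply Nat.factorization_eq_zero_of_not_dvd
      intro h
      exact hp.one_lt.ne' (Nat.eq_one_of_dvd_coprimes hcop h hdvd)
    have hlog : Real.log (padicAbv v r) =
        (r.den.factorization (natGenerator v) : ℝ) * Real.log (natGenerator v) := by
      rw [log_padicAbv hr, hnum, Nat.cast_zero, sub_zero]
    have h1 : 1 ≤ padicAbv v r := by
      rw [← Real.log_nonneg_iff ((padicAbv v).pos hr), hlog]
      positivity
    rw [Real.posLog_eq_log (by rwa [abs_of_nonneg ((padicAbv v).nonneg r)]), hlog]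
  · -- `p ∤ den`, so `|r|_p ≤ 1`
    have hden : r.den.factorization (natGenerator v) = 0 :=
      Nat.factorization_eq_zero_of_not_dvd hdvd
    have h1 : padicAbv v r ≤ 1 := by
      rw [← Real.log_nonpos_iff ((padicAbv v).nonneg r), log_padicAbv hr, hden, Nat.cast_zero,
        zero_sub, neg_mul]
      exact neg_nonpos.mpr (by positivity)
    rw [(Real.posLog_eq_zero_iff _).mpr (by rwa [abs_of_nonneg ((padicAbv v).nonneg r)]), hden,
      Nat.cast_zero, zero_mul]

/-- The function `v ↦ log⁺ |r|_v` is finitely supported (on the places above the prime factors of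
`den r`). [folklore] -/
theorem finite_support_posLog_padicAbv (r : ℚ) :
    (Function.support fun v : HeightOneSpectrum ℤ => Real.posLog (padicAbv v r)).Finite := by
  refine Set.Finite.subset (finite_support_factorization_mul_log r.den) fun v hv => ?_
  rw [Function.mem_support, posLog_padicAbv] at hv
  exact hv

/-- **The height of a rational number as a sum of local contributions**:
`log⁺|r| + Σ_p log⁺|r|_p = h(r) = log max(|num r|, den r)` (Silverman, AEC VIII.5, `H(P)` for
`P = [r, 1] ∈ ℙ¹(ℚ)`; Mathlib `Rat.logHeight₁_eq_log_max`). [folklore] -/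
theorem posLog_abs_add_finsum_posLog_padicAbv (r : ℚ) :
    Real.posLog |(r : ℝ)| + ∑ᶠ v : HeightOneSpectrum ℤ, Real.posLog (padicAbv v r) =
      Height.logHeight₁ r := by
  have hden : r.den ≠ 0 := r.den_nz
  have hden' : (0 : ℝ) < r.den := by exact_mod_cast Nat.pos_of_ne_zero hden
  have h1 : ∑ᶠ v : HeightOneSpectrum ℤ, Real.posLog (padicAbv v r) = Real.log r.den := by
    rw [← finsum_factorization_mul_log_natGenerator hden]
    exact finsum_congr fun v => posLog_padicAbv r v
  have hr' : |(r : ℝ)| = (r.num.natAbs : ℝ) / (r.den : ℝ) := by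
    have : (r : ℝ) = (r.num : ℝ) / (r.den : ℝ) := by
      rw [← Rat.cast_intCast, ← Rat.cast_natCast, ← Rat.cast_div, Rat.num_div_den]
    rw [this, abs_div, Nat.abs_cast, ← Int.cast_abs, Int.abs_eq_natAbs, Int.cast_natCast]
  have h2 : Real.posLog |(r : ℝ)| = Real.log (max r.num.natAbs r.den : ℕ) - Real.log r.den := by
    rw [Real.posLog_eq_log_max_one (abs_nonneg _), hr', ← Real.log_div (by positivity) hden'.ne']
    congr 1
    rw [Nat.cast_max, ← max_div_div_right hden'.le, div_self hden'.ne', max_comm]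
  rw [h1, h2, Rat.logHeight₁_eq_log_max, sub_add_cancel]

end Rat

/-! ### The naive height of a rational point as a sum of naive local heights -/

namespace Point

open WeierstrassCurve.Affine.Point

variable {W : WeierstrassCurve ℚ}

/-- For a rational point `P`, the naive local heights `λ₁,v(P) = ½ log⁺|x(P)|_v` vanish for all but
finitely many `p`-adic places `v`. [folklore] -/
theorem finite_support_naiveLocalHeight_padicAbv (P : W.toAffine.Point) :
    (Function.support fun v : HeightOneSpectrum ℤ => naiveLocalHeight (padicAbv v) P).Finite := by
  cases P with
  | zero => simp [← WeierstrassCurve.Affine.Point.zero_def]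
  | some x y h =>
    simp only [naiveLocalHeight_some]
    refine Set.Finite.subset (Rat.finite_support_posLog_padicAbv x) fun v hv => ?_
    rw [Function.mem_support] at hv ⊢
    intro h0
    exact hv (by rw [h0, mul_zero])

/-- **The naive case of the local decomposition** (ATAEC, proof of Thm. VI.2.1 with `c_v = 0`,
p. 461, over `ℚ`): the naive height `h(P) = h(x(P))` of a rational point is twice the sum over all
places of Tate's naive local heights `λ₁,v(P) = ½ log⁺ |x(P)|_v`:
`naiveHeight P = 2 (λ₁,∞(P) + Σ_p λ₁,p(P))` (the factor `2` because `h` is not halved in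
`Heights.lean`). [cite: Silverman1994, proof of Thm VI.2.1] -/
theorem naiveHeight_eq_two_mul (P : W.toAffine.Point) :
    naiveHeight P =
      2 * (naiveLocalHeight Rat.AbsoluteValue.real P +
        ∑ᶠ v : HeightOneSpectrum ℤ, naiveLocalHeight (padicAbv v) P) := by
  cases P with
  | zero => simp [← WeierstrassCurve.Affine.Point.zero_def]
  | some x y h =>
    simp only [naiveHeight_some, naiveLocalHeight_some]
    rw [← mul_finsum, ← mul_add, ← mul_assoc, show (2 : ℝ) * (1 / 2) = 1 by norm_num, one_mul,
      ← Rat.posLog_abs_add_finsum_posLog_padicAbv x]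
    rfl

end Point

end Literature.NumberTheory.EllipticCurves

end
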